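import Summits.KontsevichZagierPeriods.KontsevichZagierPeriods.Theorems.LiouvilleUnfoldingLogKernelConjectureIffSummit
import Summits.KontsevichZagierPeriods.KontsevichZagierPeriods.Theorems.LiouvilleUnfoldingLogKernelConjectureStubSplit
import Summits.KontsevichZagierPeriods.KontsevichZagierPeriods.Theorems.ReducedPeriodRing.Negative.RingForms
import Summits.KontsevichZagierPeriods.KontsevichZagierPeriods.Theorems.ReducedPeriodRing.Negative.DimZero
import Literature.NumberTheory.Transcendental.KZRulesAssociator
import Summits.KontsevichZagierPeriods.KontsevichZagierPeriods.Theses.Neg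
import Literature.NumberTheory.Transcendental.KZSemialgebraicComplex

/-!
# Census of the crux `LiouvilleUnfolding.LogKernelConjecture` (stmt-KontsevichZagierPeriods-2837), part 3:
# the two open stubs in the formal period ring

Route `LiouvilleUnfolding`, line `spectator-localisation` (lead, continuation seat c2). Parts 1–2
(`…IffSummit.lean`, `…Census.lean`) proved `LogKernelConjecture ↔ KZKernelConjecture ↔
KontsevichZagierPeriods ↔ DarkTorsion₁ ∧ SpectatorFibration₁` (the line's two registered open stubs).
Here both stubs are placed in the commutative ring `P := KZ.FormalPeriodRing = FormalRep ⧸ relations`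
(`KZRulesAssociator.lean`; `evalP : P →+* ℝ`, the summit being injectivity of `evalP`):
* §2 `spectatorFibration₁_iff_mem_nonZeroDivisors` — the structural stub says the class of every
  one-dimensional representation of non-zero value is a NON-ZERO-DIVISOR of `P`;
  `darkTorsion₁_iff_listProd` — the arithmetic stub says `ker evalP` is TORSION for the monoid those
  classes generate (`evalP` injective on the localisation: KZ's `P̂ = P[1/π]` with all good
  one-dimensional spectators inverted).
* §3 `summit_iff_darkTorsion₁_and_isDomain` — **`KontsevichZagierPeriods ↔ DarkTorsion₁ ∧ IsDomain P`**
  (same for the crux, `census_crux_iff_darkTorsion_and_isDomain`, the registered census sub-goal): the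
  structural half may be taken to be "the formal period ring is a domain",
  which implies `SpectatorFibration₁` outright, implies route FurushoPentagon's `ReducedPeriodRing`
  (`ReducedPeriodRingNegative.isReduced_of_isDomain`) and forbids route Neg's `CancellationGap` (§5);
  under `DarkTorsion₁` the statements `SpectatorFibration₁`, `¬ CancellationGap`, `IsDomain P`,
  `Injective evalP` all coincide with the summit.
* §4 THE UNCONDITIONAL PART of the structural stub: units of `P` cancel; the class of a
  `0`-dimensional representation of non-zero value (a non-zero real-algebraic constant) is a unit —
  by the kernel conjecture ON THE CONSTANTS, a theorem (`ReducedPeriodRingNegative.dimZero_kernel`) —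
  hence so is every representation the four rules connect to such a constant, and
  `SpectatorFibration₁` HOLDS there (`spectatorFibration₁_at_equivalent_dimZero`). The stub's content
  starts at spectators not known to be units: `[[0,1], 1/(1+t)]` (`log 2`), `[β(½,½)] ∼ [π]`
  (`KZ.PiCancellation`, stmt-0540).
* §5 `cancellation_iff_not_cancellationGap` — all-dimension spectator cancellation is EXACTLY the
  negation of route Neg's crux `CancellationGap` (stmt-11011); so `¬ CancellationGap ⇒
  SpectatorFibration₁`, and a counterexample to the stub is a one-dimensional cancellation gap.

No definition is added. References: M. Kontsevich, D. Zagier, *Periods* (2001), §1.2 Conjecture 1,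
§4.1; J. Ayoub, EMS Newsl. 91 (2014), §2.2; A. Huber, S. Müller-Stach, *Periods and Nori Motives*
(2017), §13.1–13.2.
-/

noncomputable section

open Literature.NumberTheory.Transcendental
open scoped nonZeroDivisors

namespace Summit.KontsevichZagierPeriods.LiouvilleUnfolding.LogKernelConjectureCensus

open Summit.KontsevichZagierPeriods.KontsevichZagierPeriods.Theses.LiouvilleUnfolding
  (LogKernelConjecture)
open Summit.KontsevichZagierPeriods.KontsevichZagierPeriods.ReducedPeriodRingNegative
  (kzKernelConjecture_iff_injective_evalP isDomain_of_kernel dimZero_kernel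
    value_eq_integrand_default)
open MeasureTheory Set

/-- Part 2's `summit_iff_darkTorsion_and_spectatorFibration`, re-derived from part 1 and the landed
exact split so that this file does not depend on part 2. [folklore] -/
theorem summit_iff_darkTorsion₁_and_spectatorFibration₁ :
    KontsevichZagierPeriods ↔
      ((∀ c : KZ.FormalRep, KZ.eval c = 0 → ∃ l : List (KZ.IntegralRep 1), (∀ s ∈ l, s.value ≠ 0) ∧
        List.foldr (fun s x => KZ.of s * x) c l ∈ KZ.relations) ∧
      (∀ (s : KZ.IntegralRep 1) (c : KZ.FormalRep), s.value ≠ 0 → KZ.of s * c ∈ KZ.relations →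
        ∃ c' : KZ.FormalRep, c - c' ∈ KZ.relations ∧ KZ.of s * c' ∈ KZ.fibredRelations)) :=
  SpectatorLocalisation.logKernelConjecture_iff_summit.symm.trans
    (SpectatorLocalisation.logKernelConjecture_iff_kzKernelConjecture.trans
      SpectatorLocalisation.stub_split)

/-! ## §1 List products of spectators in `P` -/

/-- The class in `P` of the registered list product `[s₁]·([s₂]·(⋯ c))` is `(∏ᵢ ⟦[sᵢ]⟧) · ⟦c⟧`
(`toFormalPeriod` is multiplicative). [folklore] -/
theorem toFormalPeriod_foldr (c : KZ.FormalRep) (l : List (KZ.IntegralRep 1)) :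
    KZ.toFormalPeriod (List.foldr (fun s x => KZ.of s * x) c l) =
      (l.map fun s => KZ.toFormalPeriod (KZ.of s)).prod * KZ.toFormalPeriod c := by
  induction l with
  | nil => simp
  | cons s l ih => rw [List.foldr_cons, map_mul, ih, List.map_cons, List.prod_cons, mul_assoc]

/-- A product of classes of good spectators has non-zero value `∏ᵢ sᵢ.value` (so it is non-zero in
`P`). [folklore] -/
theorem evalP_listProd_ne_zero {l : List (KZ.IntegralRep 1)} (hl : ∀ s ∈ l, s.value ≠ 0) :
    KZ.evalP (l.map fun s => KZ.toFormalPeriod (KZ.of s)).prod ≠ 0 := by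
  rw [map_list_prod, List.map_map]
  apply List.prod_ne_zero
  intro h
  rw [List.mem_map] at h
  obtain ⟨s, hs, h0⟩ := h
  exact hl s hs (by simpa [KZ.evalP_toFormalPeriod_of] using h0)

/-- In particular such a product is a non-zero element of `P`. [folklore] -/
theorem listProd_ne_zero {l : List (KZ.IntegralRep 1)} (hl : ∀ s ∈ l, s.value ≠ 0) :
    (l.map fun s => KZ.toFormalPeriod (KZ.of s)).prod ≠ 0 := fun h0 => evalP_listProd_ne_zero hl (by rw [h0, map_zero])

/-! ## §2 The two registered stubs in ring language -/

/-- **The structural stub is regularity of good spectators.** `SpectatorFibration₁` (registered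
signature, inlined) holds iff the class `⟦[s]⟧ ∈ P` of every one-dimensional representation of
non-zero value is a non-zero-divisor of `P` (via the landed engine, which turns the stub into plain
cancellation: `SpectatorLocalisation.stub_split_spectatorFibration_iff`). [KZ 2001, §4.1] [folklore] -/
theorem spectatorFibration₁_iff_mem_nonZeroDivisors :
    (∀ (s : KZ.IntegralRep 1) (c : KZ.FormalRep), s.value ≠ 0 → KZ.of s * c ∈ KZ.relations →
        ∃ c' : KZ.FormalRep, c - c' ∈ KZ.relations ∧ KZ.of s * c' ∈ KZ.fibredRelations) ↔
      ∀ s : KZ.IntegralRep 1, s.value ≠ 0 → KZ.toFormalPeriod (KZ.of s) ∈ KZ.FormalPeriodRing⁰ := by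
  rw [SpectatorLocalisation.stub_split_spectatorFibration_iff]
  constructor
  · intro h s hs
    rw [mem_nonZeroDivisors_iff_right]
    intro x hx
    obtain ⟨c, rfl⟩ := KZ.toFormalPeriod_surjective x
    rw [mul_comm, ← map_mul, KZ.toFormalPeriod_eq_zero_iff] at hx
    exact KZ.toFormalPeriod_eq_zero_iff.mpr (h s c hs hx)
  · intro h s c hs hsc
    have h1 : KZ.toFormalPeriod c * KZ.toFormalPeriod (KZ.of s) = 0 := by
      rw [mul_comm, ← map_mul, KZ.toFormalPeriod_eq_zero_iff]; exact hsc
    exact KZ.toFormalPeriod_eq_zero_iff.mp ((mem_nonZeroDivisors_iff_right.mp (h s hs)) _ h1)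

/-- **The arithmetic stub is a torsion statement.** `DarkTorsion₁` (registered signature, inlined)
holds iff every formal period of value `0` is killed in `P` by a finite product of classes of
one-dimensional representations of non-zero value — `ker evalP` is torsion for the monoid `S` they
generate, i.e. `evalP` is injective on `S⁻¹P` (KZ's `P̂ = P[1/π]` with all good one-dimensional
spectators inverted). [Kontsevich–Zagier 2001, §4.1; Ayoub 2014, §2.2] [folklore] -/
theorem darkTorsion₁_iff_listProd :
    (∀ c : KZ.FormalRep, KZ.eval c = 0 → ∃ l : List (KZ.IntegralRep 1), (∀ s ∈ l, s.value ≠ 0) ∧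
        List.foldr (fun s x => KZ.of s * x) c l ∈ KZ.relations) ↔
      ∀ x : KZ.FormalPeriodRing, KZ.evalP x = 0 → ∃ l : List (KZ.IntegralRep 1),
        (∀ s ∈ l, s.value ≠ 0) ∧ (l.map fun s => KZ.toFormalPeriod (KZ.of s)).prod * x = 0 := by
  constructor
  · intro h x hx
    obtain ⟨c, rfl⟩ := KZ.toFormalPeriod_surjective x
    obtain ⟨l, hl, hlc⟩ := h c (by simpa using hx)
    exact ⟨l, hl, by rw [← toFormalPeriod_foldr, KZ.toFormalPeriod_eq_zero_iff]; exact hlc⟩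
  · intro h c hc
    obtain ⟨l, hl, hlx⟩ := h (KZ.toFormalPeriod c) (by simpa using hc)
    exact ⟨l, hl, by rw [← KZ.toFormalPeriod_eq_zero_iff, toFormalPeriod_foldr]; exact hlx⟩

/-! ## §3 The structural half as "the formal period ring is a domain" -/

/-- The summit is injectivity of `evalP : P →+* ℝ` (the kernel form composed with
`ReducedPeriodRingNegative.kzKernelConjecture_iff_injective_evalP`). [Kontsevich–Zagier 2001, §1.2
Conjecture 1; Huber–Müller-Stach 2017, Conj. 13.2.1] [folklore] -/
theorem summit_iff_injective_evalP : KontsevichZagierPeriods ↔ Function.Injective KZ.evalP :=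
  (KontsevichZagierPeriods_iff.trans kzKernelConjecture_iff_isRational.symm).trans
    kzKernelConjecture_iff_injective_evalP

/-- **`IsDomain P` implies the structural stub** outright: a class of non-zero value is non-zero,
hence a non-zero-divisor of a domain. [folklore] -/
theorem spectatorFibration₁_of_isDomain (hdom : IsDomain KZ.FormalPeriodRing) :
    ∀ (s : KZ.IntegralRep 1) (c : KZ.FormalRep), s.value ≠ 0 → KZ.of s * c ∈ KZ.relations →
      ∃ c' : KZ.FormalRep, c - c' ∈ KZ.relations ∧ KZ.of s * c' ∈ KZ.fibredRelations := by
  rw [spectatorFibration₁_iff_mem_nonZeroDivisors]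
  intro s hs
  apply mem_nonZeroDivisors_of_ne_zero
  intro h0
  apply hs
  have h1 := congrArg KZ.evalP h0
  rwa [KZ.evalP_toFormalPeriod_of, map_zero] at h1

/-- **The summit is `DarkTorsion₁ ∧ IsDomain P`.** `→`: empty product, and `P ↪ ℝ`. `←`: a formal
period of value `0` is killed by a product of good spectators, a NON-ZERO element of `P` (value
`∏ sᵢ.value ≠ 0`), so in a domain it vanishes. (Part 2's conjunct `SpectatorFibration₁` is the
sharper one, `IsDomain P` the classical one.) [Kontsevich–Zagier 2001, §1.2, §4.1] [folklore] -/
theorem summit_iff_darkTorsion₁_and_isDomain :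
    KontsevichZagierPeriods ↔
      (∀ c : KZ.FormalRep, KZ.eval c = 0 → ∃ l : List (KZ.IntegralRep 1), (∀ s ∈ l, s.value ≠ 0) ∧
          List.foldr (fun s x => KZ.of s * x) c l ∈ KZ.relations) ∧
        IsDomain KZ.FormalPeriodRing := by
  constructor
  · intro h
    have hK : KZKernelConjecture :=
      kzKernelConjecture_iff_isRational.mpr (KontsevichZagierPeriods_iff.mp h)
    exact ⟨(SpectatorLocalisation.stub_split.mp hK).1, isDomain_of_kernel hK⟩
  · rintro ⟨hD, hdom⟩
    rw [KontsevichZagierPeriods_iff, ← kzKernelConjecture_iff_isRational]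
    intro c hc
    obtain ⟨l, hl, hlc⟩ := hD c hc
    have h1 : (l.map fun s => KZ.toFormalPeriod (KZ.of s)).prod * KZ.toFormalPeriod c = 0 := by
      rw [← toFormalPeriod_foldr, KZ.toFormalPeriod_eq_zero_iff]; exact hlc
    haveI := hdom
    exact KZ.toFormalPeriod_eq_zero_iff.mp ((mul_eq_zero.mp h1).resolve_left (listProd_ne_zero hl))

/-- **The crux is `DarkTorsion₁ ∧ IsDomain P`** (part 1 `logKernelConjecture_iff_summit` composed
with `summit_iff_darkTorsion₁_and_isDomain`); registered census sub-goal of the crux item. [folklore] -/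
theorem census_crux_iff_darkTorsion_and_isDomain : Summit.KontsevichZagierPeriods.KontsevichZagierPeriods.Theses.LiouvilleUnfolding.LogKernelConjecture ↔ ((∀ c : Literature.NumberTheory.Transcendental.KZ.FormalRep, Literature.NumberTheory.Transcendental.KZ.eval c = 0 → ∃ l : List (Literature.NumberTheory.Transcendental.KZ.IntegralRep 1), (∀ s ∈ l, s.value ≠ 0) ∧ List.foldr (fun s x => Literature.NumberTheory.Transcendental.KZ.of s * x) c l ∈ Literature.NumberTheory.Transcendental.KZ.relations) ∧ IsDomain Literature.NumberTheory.Transcendental.KZ.FormalPeriodRing) :=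
  SpectatorLocalisation.logKernelConjecture_iff_summit.trans summit_iff_darkTorsion₁_and_isDomain

/-- **Under the arithmetic stub the structural statements coincide**: given `DarkTorsion₁`,
`SpectatorFibration₁ ↔ IsDomain P` (both sides then being the summit, parts 2 and 3). [folklore] -/
theorem spectatorFibration₁_iff_isDomain_of_darkTorsion₁
    (hD : ∀ c : KZ.FormalRep, KZ.eval c = 0 → ∃ l : List (KZ.IntegralRep 1), (∀ s ∈ l, s.value ≠ 0) ∧
      List.foldr (fun s x => KZ.of s * x) c l ∈ KZ.relations) :
    (∀ (s : KZ.IntegralRep 1) (c : KZ.FormalRep), s.value ≠ 0 → KZ.of s * c ∈ KZ.relations →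
        ∃ c' : KZ.FormalRep, c - c' ∈ KZ.relations ∧ KZ.of s * c' ∈ KZ.fibredRelations) ↔
      IsDomain KZ.FormalPeriodRing :=
  ⟨fun hF => (summit_iff_darkTorsion₁_and_isDomain.mp
      (summit_iff_darkTorsion₁_and_spectatorFibration₁.mpr ⟨hD, hF⟩)).2,
    spectatorFibration₁_of_isDomain⟩

/-! ## §4 The unconditional part of the structural stub: unit spectators cancel -/

/-- **Units of `P` cancel**: if `⟦[s]⟧` is a unit of the formal period ring then `[s]·c ∈ relations`
forces `c ∈ relations` (any dimension, any value). [folklore] -/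
theorem cancellation_of_isUnit {k : ℕ} {s : KZ.IntegralRep k} (hu : IsUnit (KZ.toFormalPeriod (KZ.of s)))
    {c : KZ.FormalRep} (h : KZ.of s * c ∈ KZ.relations) : c ∈ KZ.relations := by
  have h1 : KZ.toFormalPeriod (KZ.of s) * KZ.toFormalPeriod c = 0 := by
    rw [← map_mul, KZ.toFormalPeriod_eq_zero_iff]; exact h
  exact KZ.toFormalPeriod_eq_zero_iff.mp (hu.mul_right_eq_zero.mp h1)

/-- **Non-zero constants are units of `P`.** The class of a `0`-dimensional representation `R` of
non-zero value — necessarily `R = [pt, a]` with `a = R.value` a non-zero real-algebraic constant — is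
a unit: its inverse is `[pt, a⁻¹]` (semialgebraic by `IsSemialgebraicFunOn.inv`), the product
`[pt, a]·[pt, a⁻¹]` being a constant of value `1`, hence `≡ [pt, 1]` by the kernel conjecture ON THE
CONSTANTS (`ReducedPeriodRingNegative.dimZero_kernel`, a theorem). [Kontsevich–Zagier 2001, §1.1
(`ℝ⁰` is a point), §4.1] [folklore] -/
theorem isUnit_toFormalPeriod_of_dimZero (R : KZ.IntegralRep 0) (hR : R.value ≠ 0) :
    IsUnit (KZ.toFormalPeriod (KZ.of R)) := by
  -- the domain is the point (an empty domain has value `0`)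
  have hdom : R.domain = univ := by
    rcases Set.eq_empty_or_nonempty R.domain with h | h
    · exact absurd (by simp [KZ.IntegralRep.value, h]) hR
    · exact Subsingleton.eq_univ_of_nonempty h
  have hval : R.value = R.integrand default := value_eq_integrand_default R hdom
  have hne : ∀ x ∈ (univ : Set (Fin 0 → ℝ)), R.integrand x ≠ 0 := fun x _ => by
    rw [Subsingleton.elim x default, ← hval]; exact hR
  have hconst : (fun x : Fin 0 → ℝ => (R.integrand x)⁻¹) = fun _ => (R.integrand default)⁻¹ :=
    funext fun x => by rw [Subsingleton.elim x default]
  -- the inverse constant `[pt, a⁻¹]`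
  let Rinv : KZ.IntegralRep 0 :=
    { domain := univ
      integrand := fun x => (R.integrand x)⁻¹
      isSemialgebraic_domain := Literature.ModelTheory.ExponentialFields.isSemialgebraic_univ
      isSemialgebraicFunOn_integrand := (hdom ▸ R.isSemialgebraicFunOn_integrand).inv hne
      integrableOn := by
        rw [hconst]
        exact integrableOn_const (hs := by simp [KZ.volume_univ_fin_zero]) }
  -- `[R]·[Rinv] ≡ [pt, 1]`: both are constants, and the difference has value `a · a⁻¹ − 1 = 0`
  have hmem : KZ.of (R.prod Rinv) - KZ.of KZ.IntegralRep.unit ∈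
      AddSubgroup.closure (Set.range fun r : KZ.IntegralRep 0 => KZ.of r) :=
    AddSubgroup.sub_mem _ (AddSubgroup.subset_closure ⟨R.prod Rinv, rfl⟩)
      (AddSubgroup.subset_closure ⟨KZ.IntegralRep.unit, rfl⟩)
  have hRinv : Rinv.value = (R.integrand default)⁻¹ := by
    rw [value_eq_integrand_default Rinv rfl]
  have heval : KZ.eval (KZ.of (R.prod Rinv) - KZ.of KZ.IntegralRep.unit) = 0 := by
    rw [map_sub, KZ.eval_of, KZ.eval_of, KZ.IntegralRep.value_prod, KZ.IntegralRep.value_unit, hRinv,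
      hval, mul_inv_cancel₀ (hval ▸ hR), sub_self]
  have hrel : KZ.of R * KZ.of Rinv - KZ.of KZ.IntegralRep.unit ∈ KZ.relations := by
    rw [KZ.of_mul_of]; exact dimZero_kernel hmem heval
  refine IsUnit.of_mul_eq_one (KZ.toFormalPeriod (KZ.of Rinv)) ?_
  rw [← map_mul, ← KZ.toFormalPeriod_of_unit, KZ.toFormalPeriod_eq_iff]
  exact hrel

/-- **Exact non-zero periods are units**: the class of every representation which the calculus
proves equal to a non-zero constant (`KZ.Equivalent s R`, `R` of dimension `0`) is a unit of `P`
(conjecturally these are all the units: `1/π`, `1/log 2`, … are not expected to be periods). [folklore] -/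
theorem isUnit_toFormalPeriod_of_equivalent_dimZero {k : ℕ} {s : KZ.IntegralRep k}
    {R : KZ.IntegralRep 0} (hsR : KZ.Equivalent s R) (hs : s.value ≠ 0) :
    IsUnit (KZ.toFormalPeriod (KZ.of s)) := by
  rw [KZ.Equivalent.toFormalPeriod_eq hsR]
  exact isUnit_toFormalPeriod_of_dimZero R (by rwa [← KZ.Equivalent.value_eq_holds hsR])

/-- **`SpectatorFibration₁` holds at every exact spectator**: for a one-dimensional `s` that the four
rules connect to a constant (e.g. `[I, g]` with a `ℚ`-semialgebraic primitive: `[[0,1], 2t]`,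
`[[a,b], (b−a)⁻¹]`, `[[0,1], 1/(2√t)]`) the registered structural stub is a theorem, with `c' := 0`;
its content begins at spectators NOT known to be units (`[[0,1], 1/(1+t)]`, `[β(½,½)] ∼ [π]`). [folklore] -/
theorem spectatorFibration₁_at_equivalent_dimZero (s : KZ.IntegralRep 1) (R : KZ.IntegralRep 0)
    (hsR : KZ.Equivalent s R) (hs : s.value ≠ 0) (c : KZ.FormalRep)
    (h : KZ.of s * c ∈ KZ.relations) :
    ∃ c' : KZ.FormalRep, c - c' ∈ KZ.relations ∧ KZ.of s * c' ∈ KZ.fibredRelations :=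
  ⟨0, by simpa using cancellation_of_isUnit (isUnit_toFormalPeriod_of_equivalent_dimZero hsR hs) h,
    by simp⟩

/-- Units are closed under products, and so is the set of good spectators at which the structural
stub holds: the non-zero-divisors of `P` form a submonoid containing the units, and the stub at `s`
is membership of `⟦[s]⟧` in it (`spectatorFibration₁_iff_mem_nonZeroDivisors`, pointwise form).
[folklore] -/
theorem cancellation_iff_mem_nonZeroDivisors {k : ℕ} (s : KZ.IntegralRep k) :
    (∀ c : KZ.FormalRep, KZ.of s * c ∈ KZ.relations → c ∈ KZ.relations) ↔
      KZ.toFormalPeriod (KZ.of s) ∈ KZ.FormalPeriodRing⁰ := by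
  rw [mem_nonZeroDivisors_iff_right]
  constructor
  · intro h x hx
    obtain ⟨c, rfl⟩ := KZ.toFormalPeriod_surjective x
    rw [mul_comm, ← map_mul, KZ.toFormalPeriod_eq_zero_iff] at hx
    exact KZ.toFormalPeriod_eq_zero_iff.mpr (h c hx)
  · intro h c hc
    have h1 : KZ.toFormalPeriod c * KZ.toFormalPeriod (KZ.of s) = 0 := by
      rw [mul_comm, ← map_mul, KZ.toFormalPeriod_eq_zero_iff]; exact hc
    exact KZ.toFormalPeriod_eq_zero_iff.mp (h _ h1)


/-! ## §5 Position against route Neg: the structural stub is "no one-dimensional cancellation gap" -/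

/-- Route Neg's hand-written product representations are the Fubini products modulo relations (same
domain `σ × τ`, integrands agreeing with `f ⊗ g` on it). [folklore] -/
theorem of_sub_of_prod_mem_relations {n k : ℕ} (r : KZ.IntegralRep n) (s : KZ.IntegralRep k)
    (rs : KZ.IntegralRep (n + k))
    (hd : rs.domain = {z | (fun i => z (Fin.castAdd k i)) ∈ r.domain ∧
      (fun j => z (Fin.natAdd n j)) ∈ s.domain})
    (hf : EqOn rs.integrand (fun z => r.integrand (fun i => z (Fin.castAdd k i)) *
      s.integrand (fun j => z (Fin.natAdd n j))) rs.domain) :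
    KZ.of rs - KZ.of (r.prod s) ∈ KZ.relations :=
  KZ.of_sub_of_mem_relations_of_eqOn (r := rs) (r' := r.prod s)
    (by rw [KZ.IntegralRep.prod_domain]; exact hd.symm)
    (fun z hz => by rw [KZ.IntegralRep.prod_integrand_eq]; exact hf hz)

/-- **All-dimension spectator cancellation is exactly the negation of route Neg's crux
`CancellationGap`** (stmt-KontsevichZagierPeriods-11011): "`[s]·c ∈ relations ⇒ c ∈ relations` for
every representation `s` of non-zero value, of any dimension" `↔ ¬ CancellationGap`. (`→`: the gap's
pair `r × s ∼ r' × s` gives `([r] − [r'])·[s] ∈ relations`; `←`: write `c ≡ [r] − [r']`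
(`KZ.exists_integralRep_sub`), commute the product modulo relations and read off a gap.)
[Kontsevich–Zagier 2001, §4.1] [folklore] -/
theorem cancellation_iff_not_cancellationGap :
    (∀ (k : ℕ) (s : KZ.IntegralRep k) (c : KZ.FormalRep), s.value ≠ 0 →
        KZ.of s * c ∈ KZ.relations → c ∈ KZ.relations) ↔
      ¬ Summit.KontsevichZagierPeriods.KontsevichZagierPeriods.Theses.Neg.CancellationGap := by
  constructor
  · rintro h ⟨n, m, k, r, r', s, rs, r's, hd, hf, hd', hf', hs0, hE, hnE⟩
    have h1 := of_sub_of_prod_mem_relations r s rs hd hf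
    have h2 := of_sub_of_prod_mem_relations r' s r's hd' hf'
    -- `[r × s] − [r' × s] ∈ relations`, i.e. `([r] − [r']) * [s] ∈ relations`
    have h3 : (KZ.of r - KZ.of r') * KZ.of s ∈ KZ.relations := by
      have heq : (KZ.of r - KZ.of r') * KZ.of s =
          (KZ.of rs - KZ.of r's) - (KZ.of rs - KZ.of (r.prod s)) + (KZ.of r's - KZ.of (r'.prod s)) := by
        rw [sub_mul, KZ.of_mul_of, KZ.of_mul_of]; abel
      rw [heq]
      exact KZ.relations.add_mem (KZ.relations.sub_mem hE h1) h2
    -- commute and cancel `[s]`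
    have h4 : KZ.of s * (KZ.of r - KZ.of r') ∈ KZ.relations := by
      have := KZ.relations.add_mem (KZ.mul_sub_mul_comm_mem_relations (KZ.of s) (KZ.of r - KZ.of r')) h3
      simpa using this
    exact hnE (h k s _ hs0 h4)
  · intro h k s c hs hsc
    by_contra hc
    apply h
    obtain ⟨n, m, r, r', hrel⟩ := KZ.exists_integralRep_sub_holds c
    refine ⟨n, m, k, r, r', s, r.prod s, r'.prod s, rfl, ?_, rfl, ?_, hs, ?_, ?_⟩
    · intro z _; rw [KZ.IntegralRep.prod_integrand_eq]; rfl
    · intro z _; rw [KZ.IntegralRep.prod_integrand_eq]; rfl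
    · -- `[r × s] − [r' × s] = ([r] − [r']) * [s] ≡ [s] * ([r] − [r']) ≡ [s] * c ≡ 0`
      change KZ.of (r.prod s) - KZ.of (r'.prod s) ∈ KZ.relations
      have h1 : KZ.of s * (KZ.of r - KZ.of r') ∈ KZ.relations := by
        have h0 : KZ.of s * c - KZ.of s * (KZ.of r - KZ.of r') ∈ KZ.relations := by
          rw [← mul_sub]; exact KZ.of_mul_mem_relations s hrel
        have := KZ.relations.sub_mem hsc h0
        simpa using this
      have h2 : (KZ.of r - KZ.of r') * KZ.of s ∈ KZ.relations := by
        have := KZ.relations.add_mem (KZ.mul_sub_mul_comm_mem_relations (KZ.of r - KZ.of r') (KZ.of s)) h1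
        simpa using this
      rwa [sub_mul, KZ.of_mul_of, KZ.of_mul_of] at h2
    · intro hrr'
      apply hc
      have := KZ.relations.add_mem hrel hrr'
      simpa using this

/-- **`¬ CancellationGap` implies the structural stub** (its one-dimensional case, with `c' := 0`):
a refutation of route Neg's crux 11011 would settle `SpectatorFibration₁`, and a counterexample to
`SpectatorFibration₁` is a (one-dimensional) cancellation gap. [folklore] -/
theorem spectatorFibration₁_of_not_cancellationGap
    (h : ¬ Summit.KontsevichZagierPeriods.KontsevichZagierPeriods.Theses.Neg.CancellationGap) :
    ∀ (s : KZ.IntegralRep 1) (c : KZ.FormalRep), s.value ≠ 0 → KZ.of s * c ∈ KZ.relations →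
      ∃ c' : KZ.FormalRep, c - c' ∈ KZ.relations ∧ KZ.of s * c' ∈ KZ.fibredRelations :=
  fun s c hs hsc => ⟨0, by simpa using (cancellation_iff_not_cancellationGap.mpr h) 1 s c hs hsc, by simp⟩

/-- **`IsDomain P` gives all-dimension cancellation** (classes of non-zero value are non-zero, hence
regular in a domain), hence forbids a cancellation gap; so `Injective evalP ⇒ IsDomain P ⇒
¬ CancellationGap ⇒ SpectatorFibration₁ ⇒ KZ.PiCancellation`, the first four coinciding under
`DarkTorsion₁` (§3). [folklore] -/
theorem cancellation_of_isDomain (hdom : IsDomain KZ.FormalPeriodRing) :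
    ∀ (k : ℕ) (s : KZ.IntegralRep k) (c : KZ.FormalRep), s.value ≠ 0 →
      KZ.of s * c ∈ KZ.relations → c ∈ KZ.relations := by
  intro k s c hs hsc
  haveI := hdom
  have hs' : KZ.toFormalPeriod (KZ.of s) ≠ 0 := fun h0 => hs (by
    have h1 := congrArg KZ.evalP h0
    rwa [KZ.evalP_toFormalPeriod_of, map_zero] at h1)
  exact (cancellation_iff_mem_nonZeroDivisors s).mpr (mem_nonZeroDivisors_of_ne_zero hs') c hsc

/-- Under `DarkTorsion₁`, `¬ CancellationGap` is again the summit (so route Neg's crux 11011 and the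
structural stub of this line are the same bet modulo the arithmetic stub). [folklore] -/
theorem not_cancellationGap_iff_summit_of_darkTorsion₁
    (hD : ∀ c : KZ.FormalRep, KZ.eval c = 0 → ∃ l : List (KZ.IntegralRep 1), (∀ s ∈ l, s.value ≠ 0) ∧
      List.foldr (fun s x => KZ.of s * x) c l ∈ KZ.relations) :
    ¬ Summit.KontsevichZagierPeriods.KontsevichZagierPeriods.Theses.Neg.CancellationGap ↔
      KontsevichZagierPeriods :=
  ⟨fun h => summit_iff_darkTorsion₁_and_spectatorFibration₁.mpr
      ⟨hD, spectatorFibration₁_of_not_cancellationGap h⟩,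
    fun h => cancellation_iff_not_cancellationGap.mp
      (cancellation_of_isDomain (summit_iff_darkTorsion₁_and_isDomain.mp h).2)⟩

end Summit.KontsevichZagierPeriods.LiouvilleUnfolding.LogKernelConjectureCensus

end
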